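import Mathlib
import HarnessLib
import Literature.Probability.Percolation.BlockResampling
import Summits.CriticalPhenomena.PercolationContinuityZ3.Theorems.PercTreeValueTetrahedronHarrisGapStubCondHarris

/-!
# Crux `PercTreeValue.TetrahedronHarrisGap` (stmt-CriticalPhenomena-7799), line `SketchIdeator1`
# (closed-collar total covariance, rev 7) — stub `stub_setIntegral_blockCondProb`

Helper file for the crux skeleton `Cruxes/TetrahedronHarrisGap/Lines/SketchIdeator1.lean`
(skeleton rev 7), `--supports stmt-CriticalPhenomena-7799`.  No new definitions; everything is
stated in the tree's vocabulary (`blockCondProb`, `DeterminedBy`, `bondPercolation`).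

**Statement** (tower property on an off-block event).  For Bernoulli bond percolation
`P_p = bondPercolation G p` on a countable graph, a finite block `K` of pairs, a measurable event
`E` and a measurable event `S` determined by the pairs OFF `K`,
`∫ 𝟙_S(ω) · P_p(E | ω off K) dP_p(ω) = P_p(E ∩ S)`,
where `P_p(E | ω off K) = blockCondProb G p K E ω` (`BlockResampling.lean`).

**Proof.**  Pointwise in `ω`: `blockCondProb G p K F ω = P_p{ζ | ω ∖ K ∪ obs ζ K ∈ F}`
(`blockCondProb_eq_real`).  The glued configuration `ω ∖ K ∪ obs ζ K` has the same trace off `K`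
as `ω` (`obs ζ K ⊆ K`), so `ω ∖ K ∪ obs ζ K ∈ S ↔ ω ∈ S` (`determinedBy_iff`).  Hence the glued
event of `E ∩ S` is the glued event of `E` if `ω ∈ S` and is empty otherwise, i.e.
`𝟙_S(ω) · P_p(E | ω off K) = P_p(E ∩ S | ω off K)` for every `ω`.  Integrate and apply the tower
property `∫ P_p(E ∩ S | ω off K) dP_p = P_p(E ∩ S)` (`integral_blockCondProb_eq`).
-/

noncomputable section

open MeasureTheory Literature.Probability.Percolation Literature.Probability.LatticeModels

namespace Summit.CriticalPhenomena.PercolationContinuityZ3.Theorems.TetrahedronHarrisGap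

/-- Gluing inside the block `K` does not change the trace off `K`:
`(ω ∖ K ∪ obs ζ K) ∩ Kᶜ = ω ∩ Kᶜ` (`obs ζ K = ζ ∩ K`). -/
theorem sdiff_union_obs_inter_compl {V : Type*} (K : Finset (Sym2 V)) (ω ζ : BondConfig V) :
    (ω \ ↑K ∪ ↑(obs ζ K)) ∩ (↑K : Set (Sym2 V))ᶜ = ω ∩ (↑K)ᶜ := by
  ext e
  simp only [Set.mem_inter_iff, Set.mem_union, Set.mem_sdiff, Finset.mem_coe, mem_obs_iff,
    Set.mem_compl_iff]
  tauto

/-- An event determined by the pairs off the block `K` is unchanged by gluing inside `K`: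
`ω ∖ K ∪ obs ζ K ∈ S ↔ ω ∈ S`. -/
theorem sdiff_union_obs_mem_iff_of_determinedBy {V : Type*} (K : Finset (Sym2 V))
    {S : Set (BondConfig V)} (hS : DeterminedBy S (↑K : Set (Sym2 V))ᶜ) (ω ζ : BondConfig V) :
    ω \ ↑K ∪ ↑(obs ζ K) ∈ S ↔ ω ∈ S :=
  (determinedBy_iff S _).1 hS _ _ (sdiff_union_obs_inter_compl K ω ζ)

/-- **Pointwise form**: for an event `S` determined off the block,
`𝟙_S(ω) · P_p(E | ω off K) = P_p(E ∩ S | ω off K)` — the glued event of `E ∩ S` is the glued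
event of `E` when `ω ∈ S`, and is empty when `ω ∉ S` (`blockCondProb_eq_real`). -/
theorem indicator_mul_blockCondProb_eq {V : Type*} [Countable V] (G : SimpleGraph V)
    (p : unitInterval) (K : Finset (Sym2 V)) (E : Set (BondConfig V)) {S : Set (BondConfig V)}
    (hS : DeterminedBy S (↑K : Set (Sym2 V))ᶜ) (ω : BondConfig V) :
    S.indicator (fun _ => (1 : ℝ)) ω * blockCondProb G p K E ω = blockCondProb G p K (E ∩ S) ω := by
  rw [blockCondProb_eq_real, blockCondProb_eq_real]
  by_cases hω : ω ∈ S
  · rw [Set.indicator_of_mem hω, one_mul]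
    congr 1
    ext ζ
    simp only [Set.mem_setOf_eq, Set.mem_inter_iff]
    exact ⟨fun h => ⟨h, (sdiff_union_obs_mem_iff_of_determinedBy K hS ω ζ).2 hω⟩, fun h => h.1⟩
  · rw [Set.indicator_of_notMem hω, zero_mul]
    have hempty : {ζ : BondConfig V | ω \ ↑K ∪ ↑(obs ζ K) ∈ E ∩ S} = ∅ := by
      ext ζ
      simp only [Set.mem_setOf_eq, Set.mem_inter_iff, Set.mem_empty_iff_false, iff_false, not_and]
      exact fun _ h => hω ((sdiff_union_obs_mem_iff_of_determinedBy K hS ω ζ).1 h)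
    rw [hempty, measureReal_empty]

/-- **stub_setIntegral_blockCondProb** (registered stub of line `SketchIdeator1`, rev 7): the
tower property on an off-block event — for `E` measurable and `S` measurable and determined by
the pairs off the finite block `K`,
`∫ 𝟙_S(ω) · P_p(E | ω off K) dP_p(ω) = P_p(E ∩ S)`.
Pointwise `𝟙_S · P_p(E | · off K) = P_p(E ∩ S | · off K)` (`indicator_mul_blockCondProb_eq`), then
`∫ P_p(E ∩ S | ω off K) dP_p = P_p(E ∩ S)` (`integral_blockCondProb_eq`). -/
theorem stub_setIntegral_blockCondProb :
    ∀ {V : Type*} [Countable V] (G : SimpleGraph V) (p : unitInterval) (K : Finset (Sym2 V)) {E S : Set (BondConfig V)},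
      MeasurableSet E → MeasurableSet S → DeterminedBy S (↑K : Set (Sym2 V))ᶜ →
      ∫ ω, S.indicator (fun _ => (1 : ℝ)) ω * blockCondProb G p K E ω ∂(bondPercolation G p) =
        (bondPercolation G p).real (E ∩ S) := by
  intro V _ G p K E S hE hS hdet
  simp_rw [indicator_mul_blockCondProb_eq G p K E hdet]
  exact integral_blockCondProb_eq G p K (hE.inter hS)

end Summit.CriticalPhenomena.PercolationContinuityZ3.Theorems.TetrahedronHarrisGap

end
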